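import Mathlib
import Summits.AnomalousDissipation.AnomalousDissipation.Theses.WazewskiBlock
import Summits.AnomalousDissipation.AnomalousDissipation.Theses.CoherentStates
import Summits.AnomalousDissipation.AnomalousDissipation.Theorems.WazewskiBlockUniformWorkFloorTrapOfLoudCycles
import Literature.Analysis.FluidPDE.LongTimeAveragePeriodic
import Literature.Analysis.FluidPDE.TorusClassicalLerayHopfProofs
import Literature.Analysis.FluidPDE.NSHopfGalerkin
import HarnessLib

/-!
# Route `WazewskiBlock`, crux `UniformWorkFloorTrap` (stmt-AnomalousDissipation-10353), line
# `work-lipschitz-cycles`: the core stub is summit-sufficient (kernel-checked honesty clause)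

Definition-free proof file (lead c3).  The single open stub of the line,
`stub_loudNondegenerateCycles` (a ν-uniformly loud, bounded, nondegenerate time-periodic classical
solution of `NS_ν(f)` for one fixed mean-zero Galerkin-mode force, at every `0 < ν ≤ ν₀`), is bracketed
FROM BELOW by the summit itself: with the nondegeneracy clauses (i)/(ii) and the mean-zero leaf
DISCARDED it already gives the conjecture-grade crux `CoherentStates.CoherentThesis`
(stmt-AnomalousDissipation-0218) — the period energy balance of a classical periodic solution turns the
pointwise work floor `(f, u t) ≥ ε` into the mean dissipation floor `⟨ν‖∇u‖²⟩ ≥ ε`, and the pointwise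
energy cap into the mean energy cap — and hence, through the route's proved deciding theorem
`CoherentStates.closes`, the summit statement `AnomalousDissipation`.  Together with the landed bridge
`uniformWorkFloorTrap_of_loudNondegenerateCycles` (p120516: core ⇒ crux) this is the triage panel's
honesty clause (TRIAGE-r1-1/r1-3, protocol (iv)) as a theorem: the core is simultaneously a proof of the
crux AND of the summit, so promoting it to an item files an object at least as hard as 0218.

Main results (namespace `…Theorems.UniformWorkFloorTrap.WorkLipschitzCycles`):
* `coherentThesis_of_loudBoundedCycles` — loud bounded classical cycles for `0 < ν ≤ ν₀` ⇒ `CoherentThesis`;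
* `coherentThesis_of_loudNondegenerateCycles` — the registered core signature verbatim ⇒ `CoherentThesis`;
* `anomalousDissipation_of_loudNondegenerateCycles` — core ⇒ `AnomalousDissipation`;
* `crux_and_summit_of_loudNondegenerateCycles` — core ⇒ `UniformWorkFloorTrap ∧ AnomalousDissipation`.
-/

noncomputable section

-- `Summit.<Summit>.<Problem>`: single-conjunct summit, the duplicate namespace is mandated (CONVENTIONS §2).
set_option linter.dupNamespace false

namespace Summit.AnomalousDissipation.AnomalousDissipation.Theorems.UniformWorkFloorTrap.WorkLipschitzCycles

open scoped InnerProductSpace Topology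
open MeasureTheory Filter Set Function UnitAddTorus
open Literature.Analysis.FunctionSpaces Literature.Analysis.FunctionSpaces.Torus
open Literature.Analysis.FluidPDE
open Summit.AnomalousDissipation.AnomalousDissipation.Theses.WazewskiBlock (UniformWorkFloorTrap)
open Summit.AnomalousDissipation.AnomalousDissipation.Theses.CoherentStates (CoherentThesis closes)

/-! ## Period bookkeeping for one loud bounded classical cycle -/

/-- **Mean energy of a pointwise-bounded periodic field.** If `u` is `τ`-periodic (`τ > 0`) with
`kineticEnergy (u t) ≤ E` for all `t`, then `meanEnergy u ≤ 2E` (the long-time mean of `∫‖u‖²` is the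
period average, `meanEnergy_eq_of_periodic`, and `∫‖u t‖² = 2·kineticEnergy (u t) ≤ 2E` slice-wise;
no integrability in time is needed: `intervalIntegral.norm_integral_le_of_norm_le_const`). [folklore] -/
theorem meanEnergy_le_of_periodic_of_kineticEnergy_le
    {u : ℝ → UnitAddTorus (Fin 3) → EuclideanSpace ℝ (Fin 3)} {τ E : ℝ}
    (hper : Function.Periodic u τ) (hτ : 0 < τ) (hE : ∀ t, kineticEnergy (u t) ≤ E) :
    meanEnergy u ≤ 2 * E := by
  rw [meanEnergy_eq_of_periodic hper hτ]
  have hbound : ∀ t ∈ Set.uIoc (0 : ℝ) τ, ‖∫ x, ‖u t x‖ ^ 2‖ ≤ 2 * E := by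
    intro t _
    have h0 : 0 ≤ ∫ x, ‖u t x‖ ^ 2 := integral_nonneg fun x => sq_nonneg _
    have h1 : 2⁻¹ * ∫ x, ‖u t x‖ ^ 2 ≤ E := hE t
    rw [Real.norm_of_nonneg h0]
    linarith
  have hint : ‖∫ t in (0 : ℝ)..τ, ∫ x, ‖u t x‖ ^ 2‖ ≤ 2 * E * |τ - 0| :=
    intervalIntegral.norm_integral_le_of_norm_le_const hbound
  rw [sub_zero, abs_of_pos hτ] at hint
  have hle : ∫ t in (0 : ℝ)..τ, ∫ x, ‖u t x‖ ^ 2 ≤ 2 * E * τ := le_trans (Real.le_norm_self _) hint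
  calc τ⁻¹ * ∫ t in (0 : ℝ)..τ, ∫ x, ‖u t x‖ ^ 2 ≤ τ⁻¹ * (2 * E * τ) :=
        mul_le_mul_of_nonneg_left hle (inv_nonneg.2 hτ.le)
    _ = 2 * E := by field_simp

/-- **Mean dissipation of a loud periodic classical cycle.** For a classical `τ`-periodic solution
`(u, p)` of `NS_ν(f)` on `ℝ × T³` (`ν, τ > 0`, steady smooth force `f`) with the pointwise work floor
`ε ≤ ∫⟪f, u t⟫` for all `t`, the mean dissipation satisfies `ε ≤ meanDissipation ν u`: the long-time
mean is the period average (`meanDissipation_eq_of_periodic`), the spectral dissipation of a smooth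
slice is `‖∇u(t)‖₂²` (`Torus.eGradNormSq_eq_ofReal_gradNormSq`), and the energy equality over one
period (`Torus.IsClassicalNSSolutionOn.energy_eq` with `u τ = u 0`) reads `ν∫₀^τ‖∇u‖² = ∫₀^τ (f, u) ≥ ετ`
(Doering–Foias 2002, §2: `ε = ⟨(f, u)⟩` for statistically steady / periodic flows). [cite: DoeringFoias2002, §2] -/
theorem le_meanDissipation_of_periodic_of_work_ge
    {ν τ ε : ℝ} {f : UnitAddTorus (Fin 3) → EuclideanSpace ℝ (Fin 3)}
    {u : ℝ → UnitAddTorus (Fin 3) → EuclideanSpace ℝ (Fin 3)} {p : ℝ → UnitAddTorus (Fin 3) → ℝ}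
    (hf : IsSmooth f) (hsol : Torus.IsClassicalNSSolutionOn Set.univ ν (fun _ => f) u p)
    (hper : Function.Periodic u τ) (hτ : 0 < τ) (hW : ∀ t, ε ≤ ∫ x, ⟪f x, u t x⟫_ℝ) :
    ε ≤ meanDissipation ν u := by
  rw [meanDissipation_eq_of_periodic hper hτ]
  have hu : IsSmoothSpaceTimeOn Set.univ u := hsol.smooth_velocity
  -- the spectral dissipation of a smooth slice is the classical one
  have hslice : ∀ t, ν * (eGradNormSq (u t)).toReal = ν * gradNormSq (u t) := by
    intro t
    rw [eGradNormSq_eq_ofReal_gradNormSq (hu.isSmooth_slice (Set.mem_univ t)),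
      ENNReal.toReal_ofReal (gradNormSq_nonneg _)]
  have hcongr : ∫ t in (0 : ℝ)..τ, ν * (eGradNormSq (u t)).toReal =
      ν * ∫ t in (0 : ℝ)..τ, gradNormSq (u t) := by
    rw [← intervalIntegral.integral_const_mul]
    exact intervalIntegral.integral_congr fun t _ => hslice t
  rw [hcongr]
  -- energy equality over one period: `ν ∫₀^τ ‖∇u‖² = ∫₀^τ (f, u)` since `u τ = u 0`
  have henergy := hsol.energy_eq convex_univ hτ.le (Set.subset_univ _)
  have hper0 : u τ = u 0 := by simpa using hper 0
  rw [hper0] at henergy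
  have hbal : ν * ∫ t in (0 : ℝ)..τ, gradNormSq (u t) = ∫ t in (0 : ℝ)..τ, ∫ x, ⟪f x, u t x⟫_ℝ := by
    linarith
  rw [hbal]
  -- the work is continuous in time, hence integrable on the period, and `≥ ε` pointwise
  have hcont : ContinuousOn (fun t => ∫ x, ⟪f x, u t x⟫_ℝ) Set.univ := by
    have h1 : ContinuousOn (fun t => ∫ x, ⟪u t x, f x⟫_ℝ) Set.univ :=
      hu.continuousOn_integral_inner (hf.memLp 2)
    refine h1.congr fun t _ => ?_
    exact integral_congr_ae (ae_of_all _ fun x => real_inner_comm _ _)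
  have hint : IntervalIntegrable (fun t => ∫ x, ⟪f x, u t x⟫_ℝ) volume 0 τ :=
    (hcont.mono (Set.subset_univ _)).intervalIntegrable
  have hlow : ∫ _ in (0 : ℝ)..τ, ε ≤ ∫ t in (0 : ℝ)..τ, ∫ x, ⟪f x, u t x⟫_ℝ :=
    intervalIntegral.integral_mono_on hτ.le intervalIntegrable_const hint fun t _ => hW t
  rw [intervalIntegral.integral_const, sub_zero, smul_eq_mul] at hlow
  calc ε = τ⁻¹ * (τ * ε) := by field_simp
    _ ≤ τ⁻¹ * ∫ t in (0 : ℝ)..τ, ∫ x, ⟪f x, u t x⟫_ℝ :=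
        mul_le_mul_of_nonneg_left hlow (inv_nonneg.2 hτ.le)

/-! ## Loud bounded cycle families give `CoherentThesis` -/

/-- **Loud bounded classical cycles for all small `ν` ⇒ `CoherentThesis` (0218).** If one steady smooth
divergence-free mean-zero force `f` carries, for every `0 < ν ≤ ν₀`, a classical `τ(ν)`-periodic
solution of `NS_ν(f)` on `ℝ × T³` with the ν-free pointwise margins `kineticEnergy (u t) ≤ E` and
`ε ≤ (f, u t)` (`ε > 0`), then along `ν_j = ν₀/(j+1) → 0` these cycles are the exact coherent states of
`CoherentStates.CoherentThesis`: mean energy `≤ 2E` (`meanEnergy_le_of_periodic_of_kineticEnergy_le`)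
and mean dissipation `≥ ε` (`le_meanDissipation_of_periodic_of_work_ge`). [folklore] -/
theorem coherentThesis_of_loudBoundedCycles
    {f : UnitAddTorus (Fin 3) → EuclideanSpace ℝ (Fin 3)}
    (hfs : IsSmooth f) (hfd : IsDivFree f) (hf0 : HasZeroMean f) {E ε ν₀ : ℝ} (hε : 0 < ε) (hν₀ : 0 < ν₀)
    (H : ∀ ν : ℝ, 0 < ν → ν ≤ ν₀ →
      ∃ (τ : ℝ) (u : ℝ → UnitAddTorus (Fin 3) → EuclideanSpace ℝ (Fin 3)) (p : ℝ → UnitAddTorus (Fin 3) → ℝ),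
        0 < τ ∧ Torus.IsClassicalNSSolutionOn Set.univ ν (fun _ => f) u p ∧ Function.Periodic u τ ∧
        ∀ t, kineticEnergy (u t) ≤ E ∧ ε ≤ ∫ x, ⟪f x, u t x⟫_ℝ) :
    CoherentThesis := by
  -- the viscosity sequence `ν_j = ν₀ / (j + 1)`
  set νs : ℕ → ℝ := fun j => ν₀ * (1 / ((j : ℝ) + 1)) with hνs
  have hνpos : ∀ j, 0 < νs j := fun j => mul_pos hν₀ (by positivity)
  have hνle : ∀ j, νs j ≤ ν₀ := by
    intro j
    have hj : (1 : ℝ) / ((j : ℝ) + 1) ≤ 1 := by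
      rw [div_le_one (by positivity)]
      linarith [(Nat.cast_nonneg j : (0 : ℝ) ≤ j)]
    calc νs j = ν₀ * (1 / ((j : ℝ) + 1)) := rfl
      _ ≤ ν₀ * 1 := mul_le_mul_of_nonneg_left hj hν₀.le
      _ = ν₀ := mul_one _
  have hνlim : Tendsto νs atTop (𝓝 0) := by
    simpa [hνs] using (tendsto_one_div_add_atTop_nhds_zero_nat (𝕜 := ℝ)).const_mul ν₀
  choose τ u p hspec using fun j => H (νs j) (hνpos j) (hνle j)
  refine ⟨f, hfs, hfd, hf0, νs, τ, u, p, hνpos, hνlim,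
    fun j => ⟨(hspec j).2.1, (hspec j).1, (hspec j).2.2.1⟩, ⟨2 * E, fun j => ?_⟩, ⟨ε, hε, fun j => ?_⟩⟩
  · exact meanEnergy_le_of_periodic_of_kineticEnergy_le (hspec j).2.2.1 (hspec j).1
      fun t => ((hspec j).2.2.2 t).1
  · exact le_meanDissipation_of_periodic_of_work_ge hfs (hspec j).2.1 (hspec j).2.2.1 (hspec j).1
      fun t => ((hspec j).2.2.2 t).2

/-- **The core stub of line `work-lipschitz-cycles` is `CoherentThesis`-sufficient** (triage honesty
clause, protocol (iv), as a theorem): the registered signature of `stub_loudNondegenerateCycles` VERBATIM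
— mean-zero Galerkin-mode force, for every `0 < ν ≤ ν₀` a classical periodic solution in the mean-zero
leaf, nondegenerate ((i) kernel = `ℂ·∂ₜu`, (ii) `∂ₜu` not in the range), pointwise margins
`kineticEnergy ≤ E`, `(f, u t) ≥ 2ε₁` — implies `CoherentStates.CoherentThesis` with the nondegeneracy
and the mean-zero leaf simply discarded (`coherentThesis_of_loudBoundedCycles`). [folklore] -/
theorem coherentThesis_of_loudNondegenerateCycles :
    (∃ (m : ℕ) (f : UnitAddTorus (Fin 3) → EuclideanSpace ℝ (Fin 3)), IsGalerkinMode m f ∧ HasZeroMean f ∧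
      ∃ (E ε₁ ν₀ : ℝ), 0 < ε₁ ∧ 0 < ν₀ ∧ ∀ ν : ℝ, 0 < ν → ν ≤ ν₀ →
      ∃ (τ : ℝ) (u : ℝ → UnitAddTorus (Fin 3) → EuclideanSpace ℝ (Fin 3)) (p : ℝ → UnitAddTorus (Fin 3) → ℝ), 0 < τ ∧
      Torus.IsClassicalNSSolutionOn Set.univ ν (fun _ => f) u p ∧ Function.Periodic u τ ∧
      (∀ t, HasZeroMean (u t)) ∧
      (∀ (w : ℝ → UnitAddTorus (Fin 3) → EuclideanSpace ℂ (Fin 3)) (q : ℝ → UnitAddTorus (Fin 3) → ℂ),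
      Torus.IsSmoothSpaceTimeOn Set.univ w → Torus.IsSmoothSpaceTimeOn Set.univ q →
      (∀ t, Torus.IsDivFreeC (w t)) → (∀ t, HasZeroMean (w t)) → Function.Periodic w τ →
      (∀ t x, Torus.timeDerivWithin Set.univ w t x =
      Torus.linearizedNSOperator ν (u t) (w t) (q t) x) →
      ∃ z : ℂ, ∀ t x, w t x =
      z • Torus.realToComplex (Torus.timeDerivWithin Set.univ u t x)) ∧
      (∀ (w : ℝ → UnitAddTorus (Fin 3) → EuclideanSpace ℂ (Fin 3)) (q : ℝ → UnitAddTorus (Fin 3) → ℂ),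
      Torus.IsSmoothSpaceTimeOn Set.univ w → Torus.IsSmoothSpaceTimeOn Set.univ q →
      (∀ t, Torus.IsDivFreeC (w t)) → (∀ t, HasZeroMean (w t)) → Function.Periodic w τ →
      ∃ t x, Torus.timeDerivWithin Set.univ w t x ≠
      Torus.linearizedNSOperator ν (u t) (w t) (q t) x +
      Torus.realToComplex (Torus.timeDerivWithin Set.univ u t x)) ∧
      (∀ t, kineticEnergy (u t) ≤ E ∧ 2 * ε₁ ≤ ∫ x, ⟪f x, u t x⟫_ℝ)) →
    CoherentThesis := by
  rintro ⟨m, f, hf, hf0, E, ε₁, ν₀, hε₁, hν₀, H⟩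
  refine coherentThesis_of_loudBoundedCycles hf.isSmooth hf.isDivFree hf0 (E := E)
    (by positivity : (0 : ℝ) < 2 * ε₁) hν₀ fun ν hν hνν₀ => ?_
  obtain ⟨τ, u, p, hτ, hsol, hper, -, -, -, hB⟩ := H ν hν hνν₀
  exact ⟨τ, u, p, hτ, hsol, hper, hB⟩

/-- **The core stub is summit-sufficient.** `stub_loudNondegenerateCycles` (registered signature
verbatim) implies the summit statement `AnomalousDissipation`, through `CoherentThesis` and the proved
deciding theorem `CoherentStates.closes` (classical global solutions are global Leray–Hopf). [folklore] -/
theorem anomalousDissipation_of_loudNondegenerateCycles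
    (hcore : ∃ (m : ℕ) (f : UnitAddTorus (Fin 3) → EuclideanSpace ℝ (Fin 3)), IsGalerkinMode m f ∧ HasZeroMean f ∧
      ∃ (E ε₁ ν₀ : ℝ), 0 < ε₁ ∧ 0 < ν₀ ∧ ∀ ν : ℝ, 0 < ν → ν ≤ ν₀ →
      ∃ (τ : ℝ) (u : ℝ → UnitAddTorus (Fin 3) → EuclideanSpace ℝ (Fin 3)) (p : ℝ → UnitAddTorus (Fin 3) → ℝ), 0 < τ ∧
      Torus.IsClassicalNSSolutionOn Set.univ ν (fun _ => f) u p ∧ Function.Periodic u τ ∧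
      (∀ t, HasZeroMean (u t)) ∧
      (∀ (w : ℝ → UnitAddTorus (Fin 3) → EuclideanSpace ℂ (Fin 3)) (q : ℝ → UnitAddTorus (Fin 3) → ℂ),
      Torus.IsSmoothSpaceTimeOn Set.univ w → Torus.IsSmoothSpaceTimeOn Set.univ q →
      (∀ t, Torus.IsDivFreeC (w t)) → (∀ t, HasZeroMean (w t)) → Function.Periodic w τ →
      (∀ t x, Torus.timeDerivWithin Set.univ w t x =
      Torus.linearizedNSOperator ν (u t) (w t) (q t) x) →
      ∃ z : ℂ, ∀ t x, w t x =
      z • Torus.realToComplex (Torus.timeDerivWithin Set.univ u t x)) ∧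
      (∀ (w : ℝ → UnitAddTorus (Fin 3) → EuclideanSpace ℂ (Fin 3)) (q : ℝ → UnitAddTorus (Fin 3) → ℂ),
      Torus.IsSmoothSpaceTimeOn Set.univ w → Torus.IsSmoothSpaceTimeOn Set.univ q →
      (∀ t, Torus.IsDivFreeC (w t)) → (∀ t, HasZeroMean (w t)) → Function.Periodic w τ →
      ∃ t x, Torus.timeDerivWithin Set.univ w t x ≠
      Torus.linearizedNSOperator ν (u t) (w t) (q t) x +
      Torus.realToComplex (Torus.timeDerivWithin Set.univ u t x)) ∧
      (∀ t, kineticEnergy (u t) ≤ E ∧ 2 * ε₁ ≤ ∫ x, ⟪f x, u t x⟫_ℝ)) :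
    _root_.AnomalousDissipation :=
  closes (coherentThesis_of_loudNondegenerateCycles hcore)

/-- **Bracket of the core, both sides at once.** The registered core stub of line
`work-lipschitz-cycles` yields the crux `WazewskiBlock.UniformWorkFloorTrap` (landed bridge
`uniformWorkFloorTrap_of_loudNondegenerateCycles`, p120516: Galerkin persistence of nondegenerate cycles)
AND the summit `AnomalousDissipation` (`anomalousDissipation_of_loudNondegenerateCycles`: nondegeneracy
discarded). So the one open obligation of the line is simultaneously crux-sufficient and
summit-sufficient: it is at least as hard as the conjecture-grade crux 0218. [folklore] -/
theorem crux_and_summit_of_loudNondegenerateCycles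
    (hcore : ∃ (m : ℕ) (f : UnitAddTorus (Fin 3) → EuclideanSpace ℝ (Fin 3)), IsGalerkinMode m f ∧ HasZeroMean f ∧
      ∃ (E ε₁ ν₀ : ℝ), 0 < ε₁ ∧ 0 < ν₀ ∧ ∀ ν : ℝ, 0 < ν → ν ≤ ν₀ →
      ∃ (τ : ℝ) (u : ℝ → UnitAddTorus (Fin 3) → EuclideanSpace ℝ (Fin 3)) (p : ℝ → UnitAddTorus (Fin 3) → ℝ), 0 < τ ∧
      Torus.IsClassicalNSSolutionOn Set.univ ν (fun _ => f) u p ∧ Function.Periodic u τ ∧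
      (∀ t, HasZeroMean (u t)) ∧
      (∀ (w : ℝ → UnitAddTorus (Fin 3) → EuclideanSpace ℂ (Fin 3)) (q : ℝ → UnitAddTorus (Fin 3) → ℂ),
      Torus.IsSmoothSpaceTimeOn Set.univ w → Torus.IsSmoothSpaceTimeOn Set.univ q →
      (∀ t, Torus.IsDivFreeC (w t)) → (∀ t, HasZeroMean (w t)) → Function.Periodic w τ →
      (∀ t x, Torus.timeDerivWithin Set.univ w t x =
      Torus.linearizedNSOperator ν (u t) (w t) (q t) x) →
      ∃ z : ℂ, ∀ t x, w t x =
      z • Torus.realToComplex (Torus.timeDerivWithin Set.univ u t x)) ∧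
      (∀ (w : ℝ → UnitAddTorus (Fin 3) → EuclideanSpace ℂ (Fin 3)) (q : ℝ → UnitAddTorus (Fin 3) → ℂ),
      Torus.IsSmoothSpaceTimeOn Set.univ w → Torus.IsSmoothSpaceTimeOn Set.univ q →
      (∀ t, Torus.IsDivFreeC (w t)) → (∀ t, HasZeroMean (w t)) → Function.Periodic w τ →
      ∃ t x, Torus.timeDerivWithin Set.univ w t x ≠
      Torus.linearizedNSOperator ν (u t) (w t) (q t) x +
      Torus.realToComplex (Torus.timeDerivWithin Set.univ u t x)) ∧
      (∀ t, kineticEnergy (u t) ≤ E ∧ 2 * ε₁ ≤ ∫ x, ⟪f x, u t x⟫_ℝ)) :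
    UniformWorkFloorTrap ∧ _root_.AnomalousDissipation :=
  ⟨uniformWorkFloorTrap_of_loudNondegenerateCycles hcore, anomalousDissipation_of_loudNondegenerateCycles hcore⟩

end Summit.AnomalousDissipation.AnomalousDissipation.Theorems.UniformWorkFloorTrap.WorkLipschitzCycles

end
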